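import Summits.Parity.GeneralizedHardyLittlewood.Theorems.FordMaynardSieveConst01651SieveConst01651BuchstabCuts
import HarnessLib

/-!
# Route `FordMaynardSieveConst01651`, target `SieveConst01651` (stmt-Parity-19185), stub `stub_certValuePos` (R2):
# the `r = 2` pairing — the face part of the witness is invisible

Def-free helper file, first step of the soundness of the rectangle sums `certP` / `certN` (`…BuchstabCert`,
`…CertAssembly.stub_certValuePos_of_pairingTwo`).  For `t ∉ {c₀, 1/2}` (`c₀ = 8349/20000`) the ordered slice function
`S⁰_2(t) = ∫_{u ∈ (0,t)} 𝟙[ν₀ < u ≤ t − u] coneCert₂(u, t−u)/(u(t−u)) du` (`sliceFnOrd_two`) only sees the TABLE part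
`gTab 2` of the witness: the face part lives on `u ∈ edgeSet ∪ (t − edgeSet)` (finite) — `sliceFnOrd_two_eq_tab`; hence
the pairing `I₂ = ∫_{(0,1/2]} S⁰_2 Φ₆(1−·)` equals its table version (`pairing_two_eq_tab`, the two exceptional `t` are null).

References: [FordMaynard2024PrimeSieves] arXiv:2407.14368, Theorem 7.3 (a), §8.2.
-/

noncomputable section

open MeasureTheory Set Finset
open scoped Classical
open Literature.NumberTheory.Sieve Literature.NumberTheory.Sieve.FordMaynard
open Literature.Analysis.Convolution

namespace Summit.Parity.GeneralizedHardyLittlewood.FordMaynardSieveConst01651SieveConst01651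

/-- Off the edges and band lines, `coneCert₂(u, t − u) = gTab₂(u, t − u)`. [folklore] -/
theorem coneCert_two_pair_eq_gTab {t u : ℝ} (ht1 : t ≠ 8349 / 20000) (ht2 : t ≠ 1 / 2)
    (hu : u ∉ edgeSet) (htu : t - u ∉ edgeSet) :
    coneCert 2 ![u, t - u] = gTab 2 ![u, t - u] := by
  have hface : gFace 2 ![u, t - u] = 0 := by
    refine gFace_eq_zero_of_generic (fun i => ?_) (fun i j hij => ?_) (fun h => absurd h (by norm_num))
    · fin_cases i
      · simpa using hu
      · simpa using htu
    · fin_cases i <;> fin_cases j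
      · exact absurd hij (by decide)
      · simp only [Fin.zero_eta, Fin.isValue, Fin.mk_one, Matrix.cons_val_zero, Matrix.cons_val_one,
          add_sub_cancel]
        exact ⟨ht1, ht2⟩
      · exact absurd hij (by decide)
      · exact absurd hij (by decide)
  show gTab 2 ![u, t - u] + gFace 2 ![u, t - u] = gTab 2 ![u, t - u]
  rw [hface, add_zero]

/-- **`S⁰_2(t)` equals its table version for `t ∉ {c₀, 1/2}`.** [folklore] -/
theorem sliceFnOrd_two_eq_tab {t : ℝ} (ht1 : t ≠ 8349 / 20000) (ht2 : t ≠ 1 / 2) :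
    sliceIntegral 2 t
        (fun v => if (∀ i, (1651 / 10000 : ℝ) < v i) ∧ Monotone v then coneCert 2 v / ∏ i, v i else 0) =
      sliceIntegral 2 t
        (fun v => if (∀ i, (1651 / 10000 : ℝ) < v i) ∧ Monotone v then gTab 2 v / ∏ i, v i else 0) := by
  rw [sliceFnOrd_two (1651 / 10000) coneCert t, sliceFnOrd_two (1651 / 10000) gTab t]
  have hN : (edgeSet ∪ (fun e => t - e) '' edgeSet).Finite := edgeSet_finite.union (edgeSet_finite.image _)
  refine integral_congr_ae ?_
  filter_upwards [ae_restrict_of_ae (hN.countable.ae_notMem (volume : Measure ℝ))] with u hu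
  simp only [Set.mem_union, Set.mem_image, not_or, not_exists, not_and] at hu
  have htu : t - u ∉ edgeSet := fun h => hu.2 (t - u) h (by ring)
  show (if (1651 / 10000 : ℝ) < u ∧ u ≤ t - u then coneCert 2 ![u, t - u] / (u * (t - u)) else 0) =
    (if (1651 / 10000 : ℝ) < u ∧ u ≤ t - u then gTab 2 ![u, t - u] / (u * (t - u)) else 0)
  rw [coneCert_two_pair_eq_gTab ht1 ht2 hu.1 htu]

/-- **The `r = 2` pairing equals its table version** (the exceptional `t ∈ {c₀, 1/2}` are null). [folklore] -/
theorem pairing_two_eq_tab (F : ℝ → ℝ) :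
    ∫ t in Set.Ioc 0 (1 / 2), sliceIntegral 2 t
        (fun v => if (∀ i, (1651 / 10000 : ℝ) < v i) ∧ Monotone v then coneCert 2 v / ∏ i, v i else 0) * F t =
      ∫ t in Set.Ioc 0 (1 / 2), sliceIntegral 2 t
        (fun v => if (∀ i, (1651 / 10000 : ℝ) < v i) ∧ Monotone v then gTab 2 v / ∏ i, v i else 0) * F t := by
  have hN : ({(8349 / 20000 : ℝ), 1 / 2} : Set ℝ).Finite := by simp
  refine integral_congr_ae ?_
  filter_upwards [ae_restrict_of_ae (hN.countable.ae_notMem (volume : Measure ℝ))] with t ht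
  simp only [Set.mem_insert_iff, Set.mem_singleton_iff, not_or] at ht
  show sliceIntegral 2 t _ * F t = sliceIntegral 2 t _ * F t
  rw [sliceFnOrd_two_eq_tab ht.1 ht.2]

end Summit.Parity.GeneralizedHardyLittlewood.FordMaynardSieveConst01651SieveConst01651

end
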